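import Summits.QuantumFields.YangMills.Theorems.BalabanUVNodesN11NoExpansionDiagonalCoPH

/-!
# DAG node N11 — THE NO-EXPANSION DIAGONAL OF K1's 𝐓-LAW AT THE v1.7 `CoPH` RECORD, PART 2: the clause-keyed level-(k+1) step under the DISPLAYED prefix
# agreement of `θ.zhAt p s′` and `θ.zhAt p (init s′)` below generation `k` (director-ym №186 (2): «restricted to components untouched by R^{(k+1)}» — a
# hypothesis on print's witness, never a record row), and the door images at `Stage13HParams.ofHistoryBlind`

Cell `pub-ymgap`, YM-PLAN Track A (HUMAN RULING D-0062), seat `pub-ymgap-dag-n11-d` (g8; R134 fan-out seat N11 [B14], strategy s2), route `BalabanUVNodes`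
rev 23, item K1⁶ `StabilityBAtRecordR13SepCoPR` = stmt-QuantumFields-20507 (helper, count-neutral; ⁷ twin after KEY-24).  [III] = [Balaban1988Convergent].
Sequel of `…NoExpansionDiagonalCoPH` (PART 1: §1 residual irrelevance along all-`Ω`-empty sequences, §2 faces, §3 level one); over node00-def-T's FILE 27
`Node00/Record13CoPH` (p537939), this seat's `…NoExpansionDiagonalClauseStep` (p535033, clause-keyed step at a free residual `Z`; §2∕§3 the v1.6 ∕ cured images)
and `…TkBranchWeightCongr` (p536516, (PC) prefix congruence).

WHY THIS FILE.  At the v1.7 record the level-(k+1) 𝐓-step along the diagonal compares the level-`k` identity at `init s′` — stated at the weights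
`WtOfRecord₁₃H θ p (init s′)` over `θ.Zh p k …` — with the 𝐓-image at `s′`, whose operation `𝐓_{k+1}(s′)` carries the weights `WtOfRecord₁₃H θ p s′` over
`θ.Zh p (k+1) …` at EVERY generation, the old ones included ((α): level-indexed, whole history).  The weights enter a length-`k` slot through the generations
`j < k` only ((PC)), so the two agree on the old factors exactly when `θ.zhAt p s′` and `θ.zhAt p (init s′)` agree on `ζ0_j`, `quad_j` for `j < k` — the displayed
hypothesis `hpre` («the old factors agree», [III] (3.24); in print a statement about the witness on components untouched by R^{(k+1)}, [IV] (0.2)–(0.3); at the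
history-blind door it is `rfl`).  With `hpre`, PART 1's residual irrelevance and p535033's free-`Z` step the v1.7 step follows with the SAME constant.

WHAT THIS FILE PROVES (0 `sorry`, 0 `def`, standard axioms; `N`-generic; every `θ : Stage13HParams`, every run).  §4 ★★ `clause_succ_CoPH_of_allLarge_pin_of_clause`
(clause of `SLaw₁₃CoPH`'s shape at `init s′` ⇒ clause of `TLaw₁₃CoPH`'s shape at `s′`, same constant, under `hpre`, the generation-`k` pin on `θ.zhAt p s′`, locality,
`quad_j(∅) = 0`, unity of def-T's `ζ`, joint measurability of `w_k(s′)`, displayed measurability ∕ bound of the old branch) ∕ `clause_succ_CoPH_of_provisos_of_clause`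
(keyed on `Provisos₁₃CoPH`) ∕ `exists_clause_succ_CoPH_of_sLaw₁₃CoPH` (keyed on `SLaw₁₃CoPH θ p k` itself).  §5 `prefix_agree_ofHistoryBlind` (`rfl`),
`clause_succ_CoPH_ofHistoryBlind_of_allLarge_pin_of_clause` (p535033 §2 verbatim at the door), `clause_succ_CoPH_ofHistoryBlind_ofCured_of_provisosCore_of_clause`
(p535033 §3 verbatim at the door of K0a's cured witness family — pins DISCHARGED).

HONEST FRAMING ∕ A6 (director-ym №189 (3)).  Kernel bookkeeping on def-T's v1.7 typing (count-neutral).  §4's binders: `hpre` is INHABITED at the history-blind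
door (`prefix_agree_ofHistoryBlind`, `rfl`); the pins `hZ`∕`hq`, locality `hloc` and ζ-unity at the door image of node00-def-K0a's cured residual (§5
`clause_succ_CoPH_ofHistoryBlind_ofCured_of_provisosCore_of_clause` — p535033 §3, K0a FILE 17∕18); `hid` is the clause of `SLaw₁₃CoPH θ p k` at `init s′`
(`exists_clause_succ_CoPH_of_sLaw₁₃CoPH`); the measurability ∕ bound `hmB`∕`hCB` of the old branch are PROPERTIES of the record's objects, displayed and NOT
exhibited (the restricted-averaging marginal density has no bound in the tree — g7's located dead end); they are jointly consistent with the rest (they constrain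
no binder the others fix).  At a history-READING `θ.Zh`, `hpre` and the pins are statements about the VALUE of `Zh` (H3) — not exhibited here.  Nothing of
Bałaban's is asserted (whether print's R^{(k+1)} leaves the all-large component untouched is [IV]-body content, unread).  N11 NOT discharged; K1⁶ NOT closed; counts unmoved (typed 28∕28 · discharged 5∕28).  One finite
four-torus programme at fixed `ε = L^{−K}`; NOT ℝ⁴, NOT OS, NOT a mass gap, NOT Clay.
Sources: [III] Theorem p.245, (2.18) p.257, (2.20)–(2.25) pp.258–259, (3.16) p.268, (3.24)–(3.25) p.270, p.267, (1.11) p.248; [IV] (0.2)–(0.3) p.176.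
-/

noncomputable section

open MeasureTheory
open scoped BigOperators Matrix.Norms.L2Operator

namespace Summit.QuantumFields.YangMills.Theorems.BalabanUVNodesN11NoExpansionDiagonalCoPHSucc

open Literature.MathematicalPhysics.QuantumFieldTheory.Balaban1983to89 T4Continuum Node00 Node00.Tk DagBinding
open B15DeterminingSets
open BalabanUVNodesN11NoExpansionAllLargeCoP (init_allLarge)
open BalabanUVNodesN11NoExpansionDiagonalClauseStep (clause_succ_atZ_of_allLarge_pin_of_clause clause_succ_CoPR_of_allLarge_pin_of_clause
  clause_succ_ofCured_of_provisosCore_of_clause)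
open BalabanUVNodesN11TkBranchWeightCongr (sect2Slot_tkWeightsOfRecordP_congr_of_prefix)
open BalabanUVNodesN11NoExpansionDiagonalCoPH (sect2Operand_congr_residual_of_forall_Omega_empty sect2Slot_congr_residual_of_forall_Omega_empty
  WtOfRecord₁₃H_eq_tkWeightsOfRecordP)

variable {F : T4Family} {N : ℕ} [NeZero N]

/-! ## §4. ★★ The clause-keyed level-(k+1) step along the diagonal at the v1.7 record, under the displayed prefix agreement -/

section LevelSucc

variable (θ : Stage13HParams F N) (p : B12.RunParams)

/-- **★★ THE NO-EXPANSION 𝐓-STEP ALONG THE DIAGONAL AT THE v1.7 `CoPH` RECORD, CLAUSE-KEYED, GENERIC `θ : Stage13HParams`.**  Let `s′` be the all-large-field new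
sequence of length `k+1` (`k < K`, `1 ≤ M`) and suppose the §2 dichotomy of the post-𝐑 slot family (the shape of `SLaw₁₃CoPH θ p k`'s clause) holds AT `init s′`
— residual `θ.rzAt p (init s′)`, weights `WtOfRecord₁₃H θ p (init s′)` — for ONE witness `t₀` and constant `E₀` (`hid`).  Suppose the HISTORY's residual
`θ.zhAt p s′` obeys 12b's locality law, has `quad_j(∅) = 0`, AGREES WITH `θ.zhAt p (init s′)` ON `ζ0_j`, `quad_j` FOR `j < k` (`hpre`: «the old factors agree» —
director-ym №186 (2): the component untouched by R^{(k+1)}; `rfl` at the history-blind door) and is PINNED at generation `k` on `T` by def-T's level-`k` step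
weight on the scale-`k` averaging graph.  Then, under unity of def-T's `ζ`, the joint measurability of `w_k(s′)` and the displayed measurability ∕ bound of the old
branch (stated at the history's objects), the 𝐓-image dichotomy (the shape of `TLaw₁₃CoPH θ p k`'s clause) AT `s′` holds for every new witness `t′` WITH THE SAME
CONSTANT `E₀`.  Proof: §1 moves both residuals to the torus's, (PC) moves `hid` to the weights of `s′`, p535033 §1 at `Z := θ.zhAt p s′`, §1 back.
[cite: Balaban1988Convergent, Theorem p.245, (3.24)–(3.25) p.270, (2.18) p.257, (2.20)–(2.25) pp.258–259, (3.16) p.268, (1.11) p.248; Balaban1989LargeFieldI, (0.2)–(0.3) p.176] -/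
theorem clause_succ_CoPH_of_allLarge_pin_of_clause {k : ℕ} (hk : k < p.K) (hM : 1 ≤ θ.τ9.M) (hζu : IsZetaUnity F N θ.ν θ.τ9.M θ.ζ)
    (s : SeqOfRecord F θ.ν θ.τ9.M (gOfRecord₁₃ F N θ.toStage13Params p) p.K (k + 1)) (hall : ∀ j, 1 ≤ j → j ≤ k + 1 → s.Ω j = ∅)
    (hloc : (θ.zhAt p s).LocalLaws) (hq : ∀ (j : ℕ) (ω : MultiCfg (F.P p.K) (SU N) (FluctV N)), (θ.zhAt p s).quad j ∅ ω = 0)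
    (hpre : ∀ j, j < k → (θ.zhAt p s).ζ0 j = (θ.zhAt p s.init).ζ0 j ∧ (θ.zhAt p s).quad j = (θ.zhAt p s.init).quad j)
    (t₀ : Sect2.TermValues (F.P p.K) (MatA N) (FluctV N) θ.τ9.M) (E₀ : ℝ)
    (hid : slotsOfRecord F N θ.ν θ.τ9 (EOfRecord₁₃ F N θ.toStage13Params) (wOfRecord₉ F N θ.toStage9Params) θ.ppSel p
        (gOfRecord₁₃ F N θ.toStage13Params p) k s.init = 0 ∨
      ∀ᵐ U₀ ∂fieldMeasure (F.P p.K) k (SU N),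
        chiSeqOfRecord F N θ.ν θ.τ9.M (gOfRecord₁₃ F N θ.toStage13Params p) p.K k s.init U₀ ≠ 0 →
          slotsOfRecord F N θ.ν θ.τ9 (EOfRecord₁₃ F N θ.toStage13Params) (wOfRecord₉ F N θ.toStage9Params) θ.ppSel p
              (gOfRecord₁₃ F N θ.toStage13Params p) k s.init U₀ =
            sect2Slot F N (FluctV N) p.K (settingOfRecord₁₃ F N θ.toStage13Params p) (θ.rzAt p s.init) (WtOfRecord₁₃H F N θ p s.init) s.init t₀ E₀
              (UbgOfRecord₁₃CoP F N θ.toStage13Params p k s.init) U₀)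
    (hZ : ∀ (V' : GaugeField (F.P p.K) (k + 1) (SU N)) (U₀ : GaugeField (F.P p.K) k (SU N)),
      (θ.zhAt p s).ζ0 k Set.univ (pairCfgAt (V := FluctV N) k V' U₀) =
        wOfRecord₉ F N θ.toStage9Params p (gOfRecord₁₃ F N θ.toStage13Params p) k s U₀ ((avOfRecord F N p.K k).avg U₀))
    (hmw : Measurable fun z : GaugeField (F.P p.K) (k + 1) (SU N) × GaugeField (F.P p.K) k (SU N) =>
      wOfRecord₉ F N θ.toStage9Params p (gOfRecord₁₃ F N θ.toStage13Params p) k s z.2 z.1)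
    {C : ℝ}
    (hmB : Measurable fun U₀ : GaugeField (F.P p.K) k (SU N) =>
        tkBranchOfRecord F N (FluctV N) θ.ν θ.τ9.M _ p.K (WtOfRecord₁₃H F N θ p s) s.init (fun _ => ∅) k
          (fun ω => sect2Operand F N (FluctV N) p.K (settingOfRecord₁₃ F N θ.toStage13Params p) (θ.rzAt p s.init) s.init t₀ E₀
            (UbgOfRecord₁₃CoP F N θ.toStage13Params p k s.init) ((fun _ => ∅ : ℕ → Set (Site (F.P p.K) 0)), fun j => (ω j).2) (fun j => (ω j).1))
          (baseCfg (V := FluctV N) k U₀))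
    (hCB : ∀ U₀ : GaugeField (F.P p.K) k (SU N),
      |tkBranchOfRecord F N (FluctV N) θ.ν θ.τ9.M _ p.K (WtOfRecord₁₃H F N θ p s) s.init (fun _ => ∅) k
          (fun ω => sect2Operand F N (FluctV N) p.K (settingOfRecord₁₃ F N θ.toStage13Params p) (θ.rzAt p s.init) s.init t₀ E₀
            (UbgOfRecord₁₃CoP F N θ.toStage13Params p k s.init) ((fun _ => ∅ : ℕ → Set (Site (F.P p.K) 0)), fun j => (ω j).2) (fun j => (ω j).1))
          (baseCfg (V := FluctV N) k U₀)| ≤ C)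
    (t' : Sect2.TermValues (F.P p.K) (MatA N) (FluctV N) θ.τ9.M) :
    slotsTOfRecord F N θ.ν θ.τ9 (EOfRecord₁₃ F N θ.toStage13Params) (wOfRecord₉ F N θ.toStage9Params) θ.ppSel p
        (gOfRecord₁₃ F N θ.toStage13Params p) (k + 1) s = 0 ∨
      ∀ᵐ V' ∂fieldMeasure (F.P p.K) (k + 1) (SU N),
        chiSeqOfRecord F N θ.ν θ.τ9.M (gOfRecord₁₃ F N θ.toStage13Params p) p.K (k + 1) s V' ≠ 0 →
          slotsTOfRecord F N θ.ν θ.τ9 (EOfRecord₁₃ F N θ.toStage13Params) (wOfRecord₉ F N θ.toStage9Params) θ.ppSel p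
              (gOfRecord₁₃ F N θ.toStage13Params p) (k + 1) s V' =
            sect2Slot F N (FluctV N) p.K (settingOfRecord₁₃ F N θ.toStage13Params p) (θ.rzAt p s) (WtOfRecord₁₃H F N θ p s) s t' E₀
              (UbgOfRecord₁₃CoP F N θ.toStage13Params p (k + 1) s) V' := by
  have hinit : ∀ j, 1 ≤ j → j ≤ k → s.init.Ω j = ∅ := init_allLarge θ.toStage13Params p s hall
  -- (i) the residuals are irrelevant along `init s′` and along `s′`
  have hop : sect2Operand F N (FluctV N) p.K (settingOfRecord₁₃ F N θ.toStage13Params p) (θ.rzAt p s.init) s.init t₀ E₀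
        (UbgOfRecord₁₃CoP F N θ.toStage13Params p k s.init) =
      sect2Operand F N (FluctV N) p.K (settingOfRecord₁₃ F N θ.toStage13Params p) (θ.Rz p.K) s.init t₀ E₀
        (UbgOfRecord₁₃CoP F N θ.toStage13Params p k s.init) :=
    sect2Operand_congr_residual_of_forall_Omega_empty _ _ _ hM s.init hinit t₀ E₀ _
  have hsl₀ : sect2Slot F N (FluctV N) p.K (settingOfRecord₁₃ F N θ.toStage13Params p) (θ.rzAt p s.init) (WtOfRecord₁₃H F N θ p s.init) s.init t₀ E₀
        (UbgOfRecord₁₃CoP F N θ.toStage13Params p k s.init) =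
      sect2Slot F N (FluctV N) p.K (settingOfRecord₁₃ F N θ.toStage13Params p) (θ.Rz p.K)
        (tkWeightsOfRecordP F N (FluctV N) θ.ν θ.A₁ p (gOfRecord₁₃ F N θ.toStage13Params p) (θ.zhAt p s)) s.init t₀ E₀
        (UbgOfRecord₁₃CoP F N θ.toStage13Params p k s.init) := by
    rw [sect2Slot_congr_residual_of_forall_Omega_empty _ (θ.rzAt p s.init) (θ.Rz p.K) _ hM s.init hinit t₀ E₀ _, WtOfRecord₁₃H_eq_tkWeightsOfRecordP]
    -- (ii) (PC): the level-`k` slot reads the weights below generation `k`, where `zhAt p s′` and `zhAt p (init s′)` agree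
    exact (sect2Slot_tkWeightsOfRecordP_congr_of_prefix θ.ν θ.τ9.M θ.A₁ p (gOfRecord₁₃ F N θ.toStage13Params p) _ _ (θ.zhAt p s) (θ.zhAt p s.init)
      (fun j hj => (hpre j hj).1) (fun j hj => (hpre j hj).2) s.init t₀ E₀ _).symm
  have hsl : sect2Slot F N (FluctV N) p.K (settingOfRecord₁₃ F N θ.toStage13Params p) (θ.rzAt p s) (WtOfRecord₁₃H F N θ p s) s t' E₀
        (UbgOfRecord₁₃CoP F N θ.toStage13Params p (k + 1) s) =
      sect2Slot F N (FluctV N) p.K (settingOfRecord₁₃ F N θ.toStage13Params p) (θ.Rz p.K)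
        (tkWeightsOfRecordP F N (FluctV N) θ.ν θ.A₁ p (gOfRecord₁₃ F N θ.toStage13Params p) (θ.zhAt p s)) s t' E₀
        (UbgOfRecord₁₃CoP F N θ.toStage13Params p (k + 1) s) := by
    rw [sect2Slot_congr_residual_of_forall_Omega_empty _ (θ.rzAt p s) (θ.Rz p.K) _ hM s hall t' E₀ _, WtOfRecord₁₃H_eq_tkWeightsOfRecordP]
  -- the old branch at the weights of `s′`: below generation `k` these are the weights passed (syntactically `WtOfRecord₁₃H θ p s′`)
  rw [WtOfRecord₁₃H_eq_tkWeightsOfRecordP] at hmB hCB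
  simp only [hop] at hmB hCB
  simp only [hsl₀] at hid
  rw [hsl]
  exact clause_succ_atZ_of_allLarge_pin_of_clause θ.toStage13Params p (θ.zhAt p s) hk hM hζu hloc hq s hall t₀ E₀ hid hZ hmw hmB hCB t'

/-- **… keyed on def-T's v1.7 core provisos** (`zetaUnity`, `zhLocal`, `tstep … .measW`): the prefix agreement, `quad_j(∅) = 0`, the generation-`k` pin, `hid`,
and the displayed measurability ∕ bound of the old branch remain. [cite: Balaban1988Convergent, Theorem p.245, (3.24)–(3.25) p.270, (3.2)–(3.9) pp.265–266] -/
theorem clause_succ_CoPH_of_provisos_of_clause (h : θ.Provisos₁₃CoPH F N) {k : ℕ} (hk : k < p.K) (hM : 1 ≤ θ.τ9.M)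
    (s : SeqOfRecord F θ.ν θ.τ9.M (gOfRecord₁₃ F N θ.toStage13Params p) p.K (k + 1)) (hall : ∀ j, 1 ≤ j → j ≤ k + 1 → s.Ω j = ∅)
    (hq : ∀ (j : ℕ) (ω : MultiCfg (F.P p.K) (SU N) (FluctV N)), (θ.zhAt p s).quad j ∅ ω = 0)
    (hpre : ∀ j, j < k → (θ.zhAt p s).ζ0 j = (θ.zhAt p s.init).ζ0 j ∧ (θ.zhAt p s).quad j = (θ.zhAt p s.init).quad j)
    (t₀ : Sect2.TermValues (F.P p.K) (MatA N) (FluctV N) θ.τ9.M) (E₀ : ℝ)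
    (hid : slotsOfRecord F N θ.ν θ.τ9 (EOfRecord₁₃ F N θ.toStage13Params) (wOfRecord₉ F N θ.toStage9Params) θ.ppSel p
        (gOfRecord₁₃ F N θ.toStage13Params p) k s.init = 0 ∨
      ∀ᵐ U₀ ∂fieldMeasure (F.P p.K) k (SU N),
        chiSeqOfRecord F N θ.ν θ.τ9.M (gOfRecord₁₃ F N θ.toStage13Params p) p.K k s.init U₀ ≠ 0 →
          slotsOfRecord F N θ.ν θ.τ9 (EOfRecord₁₃ F N θ.toStage13Params) (wOfRecord₉ F N θ.toStage9Params) θ.ppSel p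
              (gOfRecord₁₃ F N θ.toStage13Params p) k s.init U₀ =
            sect2Slot F N (FluctV N) p.K (settingOfRecord₁₃ F N θ.toStage13Params p) (θ.rzAt p s.init) (WtOfRecord₁₃H F N θ p s.init) s.init t₀ E₀
              (UbgOfRecord₁₃CoP F N θ.toStage13Params p k s.init) U₀)
    (hZ : ∀ (V' : GaugeField (F.P p.K) (k + 1) (SU N)) (U₀ : GaugeField (F.P p.K) k (SU N)),
      (θ.zhAt p s).ζ0 k Set.univ (pairCfgAt (V := FluctV N) k V' U₀) =
        wOfRecord₉ F N θ.toStage9Params p (gOfRecord₁₃ F N θ.toStage13Params p) k s U₀ ((avOfRecord F N p.K k).avg U₀))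
    {C : ℝ}
    (hmB : Measurable fun U₀ : GaugeField (F.P p.K) k (SU N) =>
        tkBranchOfRecord F N (FluctV N) θ.ν θ.τ9.M _ p.K (WtOfRecord₁₃H F N θ p s) s.init (fun _ => ∅) k
          (fun ω => sect2Operand F N (FluctV N) p.K (settingOfRecord₁₃ F N θ.toStage13Params p) (θ.rzAt p s.init) s.init t₀ E₀
            (UbgOfRecord₁₃CoP F N θ.toStage13Params p k s.init) ((fun _ => ∅ : ℕ → Set (Site (F.P p.K) 0)), fun j => (ω j).2) (fun j => (ω j).1))
          (baseCfg (V := FluctV N) k U₀))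
    (hCB : ∀ U₀ : GaugeField (F.P p.K) k (SU N),
      |tkBranchOfRecord F N (FluctV N) θ.ν θ.τ9.M _ p.K (WtOfRecord₁₃H F N θ p s) s.init (fun _ => ∅) k
          (fun ω => sect2Operand F N (FluctV N) p.K (settingOfRecord₁₃ F N θ.toStage13Params p) (θ.rzAt p s.init) s.init t₀ E₀
            (UbgOfRecord₁₃CoP F N θ.toStage13Params p k s.init) ((fun _ => ∅ : ℕ → Set (Site (F.P p.K) 0)), fun j => (ω j).2) (fun j => (ω j).1))
          (baseCfg (V := FluctV N) k U₀)| ≤ C)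
    (t' : Sect2.TermValues (F.P p.K) (MatA N) (FluctV N) θ.τ9.M) :
    slotsTOfRecord F N θ.ν θ.τ9 (EOfRecord₁₃ F N θ.toStage13Params) (wOfRecord₉ F N θ.toStage9Params) θ.ppSel p
        (gOfRecord₁₃ F N θ.toStage13Params p) (k + 1) s = 0 ∨
      ∀ᵐ V' ∂fieldMeasure (F.P p.K) (k + 1) (SU N),
        chiSeqOfRecord F N θ.ν θ.τ9.M (gOfRecord₁₃ F N θ.toStage13Params p) p.K (k + 1) s V' ≠ 0 →
          slotsTOfRecord F N θ.ν θ.τ9 (EOfRecord₁₃ F N θ.toStage13Params) (wOfRecord₉ F N θ.toStage9Params) θ.ppSel p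
              (gOfRecord₁₃ F N θ.toStage13Params p) (k + 1) s V' =
            sect2Slot F N (FluctV N) p.K (settingOfRecord₁₃ F N θ.toStage13Params p) (θ.rzAt p s) (WtOfRecord₁₃H F N θ p s) s t' E₀
              (UbgOfRecord₁₃CoP F N θ.toStage13Params p (k + 1) s) V' :=
  clause_succ_CoPH_of_allLarge_pin_of_clause θ p hk hM h.zetaUnity s hall (h.zhLocal p (k + 1) s.Ω s.Λ) hq hpre t₀ E₀ hid hZ
    ((h.tstep p k hk).measW s) hmB hCB t'

/-- **… keyed on `SLaw₁₃CoPH θ p k` ITSELF** (its witness `(t, E_k)` supplies `hid` at `init s′`; the old-branch measurability ∕ bound are then displayed for every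
`(t₀, E₀)`): the 𝐓-image clause at `s′` holds for every `t′` with `E_{k+1}(s′) := E_k(init s′)`. [cite: Balaban1988Convergent, Theorem p.245, Thm 1 p.262, (3.24)–(3.25) p.270] -/
theorem exists_clause_succ_CoPH_of_sLaw₁₃CoPH (h : θ.Provisos₁₃CoPH F N) {k : ℕ} (hk : k < p.K) (hM : 1 ≤ θ.τ9.M) (hS : SLaw₁₃CoPH F N θ p k)
    (s : SeqOfRecord F θ.ν θ.τ9.M (gOfRecord₁₃ F N θ.toStage13Params p) p.K (k + 1)) (hall : ∀ j, 1 ≤ j → j ≤ k + 1 → s.Ω j = ∅)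
    (hq : ∀ (j : ℕ) (ω : MultiCfg (F.P p.K) (SU N) (FluctV N)), (θ.zhAt p s).quad j ∅ ω = 0)
    (hpre : ∀ j, j < k → (θ.zhAt p s).ζ0 j = (θ.zhAt p s.init).ζ0 j ∧ (θ.zhAt p s).quad j = (θ.zhAt p s.init).quad j)
    (hZ : ∀ (V' : GaugeField (F.P p.K) (k + 1) (SU N)) (U₀ : GaugeField (F.P p.K) k (SU N)),
      (θ.zhAt p s).ζ0 k Set.univ (pairCfgAt (V := FluctV N) k V' U₀) =
        wOfRecord₉ F N θ.toStage9Params p (gOfRecord₁₃ F N θ.toStage13Params p) k s U₀ ((avOfRecord F N p.K k).avg U₀))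
    {C : ℝ}
    (hmB : ∀ (t₀ : Sect2.TermValues (F.P p.K) (MatA N) (FluctV N) θ.τ9.M) (E₀ : ℝ), Measurable fun U₀ : GaugeField (F.P p.K) k (SU N) =>
        tkBranchOfRecord F N (FluctV N) θ.ν θ.τ9.M _ p.K (WtOfRecord₁₃H F N θ p s) s.init (fun _ => ∅) k
          (fun ω => sect2Operand F N (FluctV N) p.K (settingOfRecord₁₃ F N θ.toStage13Params p) (θ.rzAt p s.init) s.init t₀ E₀
            (UbgOfRecord₁₃CoP F N θ.toStage13Params p k s.init) ((fun _ => ∅ : ℕ → Set (Site (F.P p.K) 0)), fun j => (ω j).2) (fun j => (ω j).1))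
          (baseCfg (V := FluctV N) k U₀))
    (hCB : ∀ (t₀ : Sect2.TermValues (F.P p.K) (MatA N) (FluctV N) θ.τ9.M) (E₀ : ℝ) (U₀ : GaugeField (F.P p.K) k (SU N)),
      |tkBranchOfRecord F N (FluctV N) θ.ν θ.τ9.M _ p.K (WtOfRecord₁₃H F N θ p s) s.init (fun _ => ∅) k
          (fun ω => sect2Operand F N (FluctV N) p.K (settingOfRecord₁₃ F N θ.toStage13Params p) (θ.rzAt p s.init) s.init t₀ E₀
            (UbgOfRecord₁₃CoP F N θ.toStage13Params p k s.init) ((fun _ => ∅ : ℕ → Set (Site (F.P p.K) 0)), fun j => (ω j).2) (fun j => (ω j).1))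
          (baseCfg (V := FluctV N) k U₀)| ≤ C)
    (t' : Sect2.TermValues (F.P p.K) (MatA N) (FluctV N) θ.τ9.M) :
    ∃ E' : ℝ,
      slotsTOfRecord F N θ.ν θ.τ9 (EOfRecord₁₃ F N θ.toStage13Params) (wOfRecord₉ F N θ.toStage9Params) θ.ppSel p
          (gOfRecord₁₃ F N θ.toStage13Params p) (k + 1) s = 0 ∨
        ∀ᵐ V' ∂fieldMeasure (F.P p.K) (k + 1) (SU N),
          chiSeqOfRecord F N θ.ν θ.τ9.M (gOfRecord₁₃ F N θ.toStage13Params p) p.K (k + 1) s V' ≠ 0 →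
            slotsTOfRecord F N θ.ν θ.τ9 (EOfRecord₁₃ F N θ.toStage13Params) (wOfRecord₉ F N θ.toStage9Params) θ.ppSel p
                (gOfRecord₁₃ F N θ.toStage13Params p) (k + 1) s V' =
              sect2Slot F N (FluctV N) p.K (settingOfRecord₁₃ F N θ.toStage13Params p) (θ.rzAt p s) (WtOfRecord₁₃H F N θ p s) s t' E'
                (UbgOfRecord₁₃CoP F N θ.toStage13Params p (k + 1) s) V' := by
  obtain ⟨t, Ek, -, hs⟩ := (sLaw₁₃CoPH_iff F N θ p k).1 hS
  exact ⟨Ek s.init, clause_succ_CoPH_of_provisos_of_clause θ p h hk hM s hall hq hpre (t s.init) (Ek s.init) (hs s.init).2 hZ (hmB _ _) (hCB _ _) t'⟩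

end LevelSucc

/-! ## §5. The door images: at `Stage13HParams.ofHistoryBlind θ` the prefix agreement is `rfl` and the v1.6 theorems are the v1.7 statements verbatim -/

section Door

variable (θ : Stage13RParams F N) (p : B12.RunParams)

/-- At the history-blind door the residual serving every history is the run's `Zr p` (`rfl`), so **the prefix agreement holds by `rfl`**. [cite: Balaban1988Convergent, p.257 (bookkeeping)] -/
theorem prefix_agree_ofHistoryBlind {k : ℕ}
    (s : SeqOfRecord F θ.ν θ.τ9.M (gOfRecord₁₃ F N θ.toStage13Params p) p.K (k + 1)) :
    ∀ j, j < k → ((Stage13HParams.ofHistoryBlind F N θ).zhAt p s).ζ0 j = ((Stage13HParams.ofHistoryBlind F N θ).zhAt p s.init).ζ0 j ∧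
      ((Stage13HParams.ofHistoryBlind F N θ).zhAt p s).quad j = ((Stage13HParams.ofHistoryBlind F N θ).zhAt p s.init).quad j :=
  fun _ _ => ⟨rfl, rfl⟩

/-- **THE v1.6 CLAUSE-KEYED STEP IS THE v1.7 ONE AT THE DOOR** (p535033 §2 `clause_succ_CoPR_of_allLarge_pin_of_clause`, verbatim: `zhAt ↦ θ.Zr p`, `rzAt ↦ θ.Rz p.K`,
`WtOfRecord₁₃H (ofHistoryBlind θ) p s ↦ WtOfRecord₁₃R θ p`, all `rfl`). [cite: Balaban1988Convergent, Theorem p.245, (3.24)–(3.25) p.270] -/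
theorem clause_succ_CoPH_ofHistoryBlind_of_allLarge_pin_of_clause {k : ℕ} (hk : k < p.K) (hM : 1 ≤ θ.τ9.M) (hζu : IsZetaUnity F N θ.ν θ.τ9.M θ.ζ)
    (hloc : (θ.Zr p).LocalLaws) (hq : ∀ (j : ℕ) (ω : MultiCfg (F.P p.K) (SU N) (FluctV N)), (θ.Zr p).quad j ∅ ω = 0)
    (s : SeqOfRecord F θ.ν θ.τ9.M (gOfRecord₁₃ F N θ.toStage13Params p) p.K (k + 1)) (hall : ∀ j, 1 ≤ j → j ≤ k + 1 → s.Ω j = ∅)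
    (t₀ : Sect2.TermValues (F.P p.K) (MatA N) (FluctV N) θ.τ9.M) (E₀ : ℝ)
    (hid : slotsOfRecord F N θ.ν θ.τ9 (EOfRecord₁₃ F N θ.toStage13Params) (wOfRecord₉ F N θ.toStage9Params) θ.ppSel p
        (gOfRecord₁₃ F N θ.toStage13Params p) k s.init = 0 ∨
      ∀ᵐ U₀ ∂fieldMeasure (F.P p.K) k (SU N),
        chiSeqOfRecord F N θ.ν θ.τ9.M (gOfRecord₁₃ F N θ.toStage13Params p) p.K k s.init U₀ ≠ 0 →
          slotsOfRecord F N θ.ν θ.τ9 (EOfRecord₁₃ F N θ.toStage13Params) (wOfRecord₉ F N θ.toStage9Params) θ.ppSel p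
              (gOfRecord₁₃ F N θ.toStage13Params p) k s.init U₀ =
            sect2Slot F N (FluctV N) p.K (settingOfRecord₁₃ F N θ.toStage13Params p) ((Stage13HParams.ofHistoryBlind F N θ).rzAt p s.init)
              (WtOfRecord₁₃H F N (Stage13HParams.ofHistoryBlind F N θ) p s.init) s.init t₀ E₀
              (UbgOfRecord₁₃CoP F N θ.toStage13Params p k s.init) U₀)
    (hZ : ∀ (V' : GaugeField (F.P p.K) (k + 1) (SU N)) (U₀ : GaugeField (F.P p.K) k (SU N)),
      (θ.Zr p).ζ0 k Set.univ (pairCfgAt (V := FluctV N) k V' U₀) =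
        wOfRecord₉ F N θ.toStage9Params p (gOfRecord₁₃ F N θ.toStage13Params p) k s U₀ ((avOfRecord F N p.K k).avg U₀))
    (hmw : Measurable fun z : GaugeField (F.P p.K) (k + 1) (SU N) × GaugeField (F.P p.K) k (SU N) =>
      wOfRecord₉ F N θ.toStage9Params p (gOfRecord₁₃ F N θ.toStage13Params p) k s z.2 z.1)
    {C : ℝ}
    (hmB : Measurable fun U₀ : GaugeField (F.P p.K) k (SU N) =>
        tkBranchOfRecord F N (FluctV N) θ.ν θ.τ9.M _ p.K (WtOfRecord₁₃H F N (Stage13HParams.ofHistoryBlind F N θ) p s) s.init (fun _ => ∅) k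
          (fun ω => sect2Operand F N (FluctV N) p.K (settingOfRecord₁₃ F N θ.toStage13Params p) ((Stage13HParams.ofHistoryBlind F N θ).rzAt p s.init)
            s.init t₀ E₀ (UbgOfRecord₁₃CoP F N θ.toStage13Params p k s.init)
            ((fun _ => ∅ : ℕ → Set (Site (F.P p.K) 0)), fun j => (ω j).2) (fun j => (ω j).1))
          (baseCfg (V := FluctV N) k U₀))
    (hCB : ∀ U₀ : GaugeField (F.P p.K) k (SU N),
      |tkBranchOfRecord F N (FluctV N) θ.ν θ.τ9.M _ p.K (WtOfRecord₁₃H F N (Stage13HParams.ofHistoryBlind F N θ) p s) s.init (fun _ => ∅) k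
          (fun ω => sect2Operand F N (FluctV N) p.K (settingOfRecord₁₃ F N θ.toStage13Params p) ((Stage13HParams.ofHistoryBlind F N θ).rzAt p s.init)
            s.init t₀ E₀ (UbgOfRecord₁₃CoP F N θ.toStage13Params p k s.init)
            ((fun _ => ∅ : ℕ → Set (Site (F.P p.K) 0)), fun j => (ω j).2) (fun j => (ω j).1))
          (baseCfg (V := FluctV N) k U₀)| ≤ C)
    (t' : Sect2.TermValues (F.P p.K) (MatA N) (FluctV N) θ.τ9.M) :
    slotsTOfRecord F N θ.ν θ.τ9 (EOfRecord₁₃ F N θ.toStage13Params) (wOfRecord₉ F N θ.toStage9Params) θ.ppSel p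
        (gOfRecord₁₃ F N θ.toStage13Params p) (k + 1) s = 0 ∨
      ∀ᵐ V' ∂fieldMeasure (F.P p.K) (k + 1) (SU N),
        chiSeqOfRecord F N θ.ν θ.τ9.M (gOfRecord₁₃ F N θ.toStage13Params p) p.K (k + 1) s V' ≠ 0 →
          slotsTOfRecord F N θ.ν θ.τ9 (EOfRecord₁₃ F N θ.toStage13Params) (wOfRecord₉ F N θ.toStage9Params) θ.ppSel p
              (gOfRecord₁₃ F N θ.toStage13Params p) (k + 1) s V' =
            sect2Slot F N (FluctV N) p.K (settingOfRecord₁₃ F N θ.toStage13Params p) ((Stage13HParams.ofHistoryBlind F N θ).rzAt p s)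
              (WtOfRecord₁₃H F N (Stage13HParams.ofHistoryBlind F N θ) p s) s t' E₀
              (UbgOfRecord₁₃CoP F N θ.toStage13Params p (k + 1) s) V' :=
  clause_succ_CoPR_of_allLarge_pin_of_clause θ p hk hM hζu hloc hq s hall t₀ E₀ hid hZ hmw hmB hCB t'

variable (θ₀ : Stage13Params F N)

/-- **AT K0a's CURED WITNESS FAMILY SEEN THROUGH THE DOOR**, `Stage13HParams.ofHistoryBlind (Stage13RParams.ofCured θ₀)` (the K0⁷ ⟸ K0⁶ lift): p535033 §3
`clause_succ_ofCured_of_provisosCore_of_clause` verbatim — pins DISCHARGED by the cured residual, only `θ₀.Provisos₁₃Core`, `k < K`, `1 ≤ M`, `hid` and the displayed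
measurability ∕ bound of the old branch remain. [cite: Balaban1988Convergent, Theorem p.245, (3.24)–(3.25) p.270, (1.11) p.248] -/
theorem clause_succ_CoPH_ofHistoryBlind_ofCured_of_provisosCore_of_clause (h : θ₀.Provisos₁₃Core F N) {k : ℕ} (hk : k < p.K) (hM : 1 ≤ θ₀.τ9.M)
    (s : SeqOfRecord F θ₀.ν θ₀.τ9.M (gOfRecord₁₃ F N θ₀ p) p.K (k + 1)) (hall : ∀ j, 1 ≤ j → j ≤ k + 1 → s.Ω j = ∅)
    (t₀ : Sect2.TermValues (F.P p.K) (MatA N) (FluctV N) θ₀.τ9.M) (E₀ : ℝ)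
    (hid : slotsOfRecord F N θ₀.ν θ₀.τ9 (EOfRecord₁₃ F N θ₀) (wOfRecord₉ F N θ₀.toStage9Params) θ₀.ppSel p (gOfRecord₁₃ F N θ₀ p) k s.init = 0 ∨
      ∀ᵐ U₀ ∂fieldMeasure (F.P p.K) k (SU N),
        chiSeqOfRecord F N θ₀.ν θ₀.τ9.M (gOfRecord₁₃ F N θ₀ p) p.K k s.init U₀ ≠ 0 →
          slotsOfRecord F N θ₀.ν θ₀.τ9 (EOfRecord₁₃ F N θ₀) (wOfRecord₉ F N θ₀.toStage9Params) θ₀.ppSel p (gOfRecord₁₃ F N θ₀ p) k s.init U₀ =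
            sect2Slot F N (FluctV N) p.K (settingOfRecord₁₃ F N θ₀ p)
              ((Stage13HParams.ofHistoryBlind F N (Stage13RParams.ofCured F N θ₀)).rzAt p s.init)
              (WtOfRecord₁₃H F N (Stage13HParams.ofHistoryBlind F N (Stage13RParams.ofCured F N θ₀)) p s.init) s.init t₀ E₀
              (UbgOfRecord₁₃CoP F N θ₀ p k s.init) U₀)
    {C : ℝ}
    (hmB : Measurable fun U₀ : GaugeField (F.P p.K) k (SU N) =>
        tkBranchOfRecord F N (FluctV N) θ₀.ν θ₀.τ9.M _ p.K (WtOfRecord₁₃H F N (Stage13HParams.ofHistoryBlind F N (Stage13RParams.ofCured F N θ₀)) p s)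
          s.init (fun _ => ∅) k
          (fun ω => sect2Operand F N (FluctV N) p.K (settingOfRecord₁₃ F N θ₀ p)
            ((Stage13HParams.ofHistoryBlind F N (Stage13RParams.ofCured F N θ₀)).rzAt p s.init) s.init t₀ E₀
            (UbgOfRecord₁₃CoP F N θ₀ p k s.init) ((fun _ => ∅ : ℕ → Set (Site (F.P p.K) 0)), fun j => (ω j).2) (fun j => (ω j).1))
          (baseCfg (V := FluctV N) k U₀))
    (hCB : ∀ U₀ : GaugeField (F.P p.K) k (SU N),
      |tkBranchOfRecord F N (FluctV N) θ₀.ν θ₀.τ9.M _ p.K (WtOfRecord₁₃H F N (Stage13HParams.ofHistoryBlind F N (Stage13RParams.ofCured F N θ₀)) p s)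
          s.init (fun _ => ∅) k
          (fun ω => sect2Operand F N (FluctV N) p.K (settingOfRecord₁₃ F N θ₀ p)
            ((Stage13HParams.ofHistoryBlind F N (Stage13RParams.ofCured F N θ₀)).rzAt p s.init) s.init t₀ E₀
            (UbgOfRecord₁₃CoP F N θ₀ p k s.init) ((fun _ => ∅ : ℕ → Set (Site (F.P p.K) 0)), fun j => (ω j).2) (fun j => (ω j).1))
          (baseCfg (V := FluctV N) k U₀)| ≤ C)
    (t' : Sect2.TermValues (F.P p.K) (MatA N) (FluctV N) θ₀.τ9.M) :
    slotsTOfRecord F N θ₀.ν θ₀.τ9 (EOfRecord₁₃ F N θ₀) (wOfRecord₉ F N θ₀.toStage9Params) θ₀.ppSel p (gOfRecord₁₃ F N θ₀ p) (k + 1) s = 0 ∨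
      ∀ᵐ V' ∂fieldMeasure (F.P p.K) (k + 1) (SU N),
        chiSeqOfRecord F N θ₀.ν θ₀.τ9.M (gOfRecord₁₃ F N θ₀ p) p.K (k + 1) s V' ≠ 0 →
          slotsTOfRecord F N θ₀.ν θ₀.τ9 (EOfRecord₁₃ F N θ₀) (wOfRecord₉ F N θ₀.toStage9Params) θ₀.ppSel p (gOfRecord₁₃ F N θ₀ p) (k + 1) s V' =
            sect2Slot F N (FluctV N) p.K (settingOfRecord₁₃ F N θ₀ p)
              ((Stage13HParams.ofHistoryBlind F N (Stage13RParams.ofCured F N θ₀)).rzAt p s)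
              (WtOfRecord₁₃H F N (Stage13HParams.ofHistoryBlind F N (Stage13RParams.ofCured F N θ₀)) p s) s t' E₀
              (UbgOfRecord₁₃CoP F N θ₀ p (k + 1) s) V' :=
  clause_succ_ofCured_of_provisosCore_of_clause θ₀ p h hk hM s hall t₀ E₀ hid hmB hCB t'

end Door

end Summit.QuantumFields.YangMills.Theorems.BalabanUVNodesN11NoExpansionDiagonalCoPHSucc

end
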